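import Literature.Analysis.FluidPDE.WholeSpaceIBP
import Literature.Analysis.FluidPDE.MildSolutionProofs
import Literature.Analysis.FluidPDE.WeakSolutionProofs
import Literature.Analysis.FluidPDE.ClassicalSolutionCalculus
import Literature.Analysis.FluidPDE.HeatDuhamelBack
import Mathlib.MeasureTheory.Integral.Prod
import Mathlib.MeasureTheory.Integral.IntegralEqImproper
import HarnessLib

/-!
# Calculus of the cut-off caloric field `φ e`: test-field Leibniz rules and the classical
# energy identities of a smooth divergence-free solution of the heat equation

Analysis/FluidPDE support file (theorems only, no new definitions or named facts) for the
Calderón / Rusin–Šverák route to the far-field regularity of Kato's mild `L³` solution near the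
blow-up time (`Literature.Analysis.FluidPDE.IsKatoSolutionOn.farField_bound`,
`RusinSverakSingularPoint.lean`; W. Rusin, V. Šverák, *Minimal initial data for potential
Navier–Stokes singularities*, J. Funct. Anal. 260 (2011) = arXiv:0911.0500, §4 p. 6: "`u = a + v`
[...] for sufficiently large `R > 0` the assumptions of Proposition 2.1 are satisfied for our
solution `(u, p)` and `Q_{z₀,r}` with `z₀ = (x₀, T)` and `|x₀| > R`"; C. P. Calderón, Trans. AMS
318 (1990), §1; P. G. Lemarié-Rieusset, *The Navier–Stokes problem in the 21st century* (2016),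
Prop. 15.1 and proof of Thm. 14.7, pp. 515–516: the local energy balance of the difference
`w = u - e` of a suitable weak solution `u` and a regular field `e` is obtained from "the three
balances for `|u|²/2`, `u·e`, `|e|²/2`").

In that route the Kato solution `u` on `[0, T)` is written `u = e + w` with `e = e^{νtΔ}u₀` the
caloric extension of the (bounded, after a restart) datum and `w` the finite-energy remainder;
the local energy inequality of `u` (suitability), the distributional momentum equation tested
with `ψ = φ e`, the weak-gradient identity tested with `φ ∂ⱼeᵢ`, and the *classical* energy
identity of `e` combine into a local energy inequality for `w` (`CaloricRemainderLocalEnergy`).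
This file supplies the two smooth ingredients, for a globally smooth space–time field
`e : ℝ → E → E` (in the application: the caloric extension cut off smoothly in time near
`t = 0`) and a space–time test function `φ`:

* **Leibniz rules for the test field `ψ = φ e`** (`IsSpaceTimeTestOn.smul_field`,
  `timeDeriv_smul_field`, `convect_smul_field`, `divergence_smul_field`,
  `laplacian_smul_field`): `∂ₜψ = φₜ e + φ ∂ₜe`, `(u·∇)ψ = (∇φ·u) e + φ (u·∇)e`,
  `div ψ = ⟪e, ∇φ⟫` (`div e = 0`), `Δψ = φ Δe + 2 De(∇φ) + (Δφ) e`;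
* **slice identities** for a `C²` field `v` and a compactly supported `θ` (Green's formula and
  the trilinear convection identity without boundary, `WholeSpaceIBP.lean`):
  `∫ θ ⟪Δv, v⟫ = -∫ θ |Dv|² - ∫ ⟪Dv(∇θ), v⟫` (`integral_mul_inner_laplacian_self`),
  `∫ ⟪Dv(∇θ), v⟫ = -½ ∫ |v|² Δθ` (`integral_inner_fderiv_gradient_self`),
  `∫ θ ⟪Dv(v), v⟫ = -½ ∫ ⟪v, ∇θ⟫ |v|²` for divergence-free `v`
  (`integral_mul_inner_convect_self_of_isDivFree`);
* **the classical local energy identity of the heat flow**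
  (`caloric_local_energy_identity`): if `∂ₜe = νΔe` on an open `Ω ⊆ ℝ × E` and `φ ∈ C_c^∞(Ω)`,
  then `∫∫ |e|² φₜ + ν ∫∫ |e|² Δφ = 2ν ∫∫ |De|² φ` (space–time integrals over `ℝ × E`), i.e.
  `∂ₜ|e|² = νΔ|e|² - 2ν|∇e|²` in `𝒟'(Ω)` (Lemarié-Rieusset 2016, p. 515, the balance for
  `|u₁|²/2` of the regular solution; Evans, *PDE*, §2.3.1 and §7.1.2 (energy estimates for the
  heat equation)).

## Mathlib / tree search

Tree (`lean search 'integral_inner_laplacian_add_eq_zero|integral_inner_convect_add_eq_zero|laplacian_smul_apply'`):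
`integral_inner_laplacian_add_eq_zero` (Green without boundary),
`integral_inner_convect_add_eq_zero` (trilinear identity), `integral_mul_divergence_add_eq_zero_left`,
`divergence_smul_apply`, `convect_smul_apply`, `laplacian_eq_sum_fderiv_fderiv`
(`WholeSpaceIBP.lean`); `laplacian_smul_apply` (`MildSolutionProofs.lean`);
`IsSpaceTimeTestOn.timeDeriv_eq_zero`, `.fderiv_slice_eq_zero`, `.laplacian_slice_eq_zero`
(`WeakSolutionProofs.lean`). Mathlib: `deriv_smul`, `fderiv_inner_apply`,
`OrthonormalBasis.sum_repr'`, `integral_eq_zero_of_hasDerivAt_of_integrable`, `integral_prod`,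
`integral_prod_symm`, `Continuous.integrable_of_hasCompactSupport`.

## References

* W. Rusin, V. Šverák, J. Funct. Anal. 260 (2011) 879–891 = arXiv:0911.0500, §4 p. 6.
  [RusinSverak2011]
* P. G. Lemarié-Rieusset, *The Navier–Stokes problem in the 21st century*, CRC Press 2016,
  Prop. 15.1; Thm. 14.7, proof pp. 515–516. [LemarieRieusset2016]
* L. C. Evans, *Partial differential equations*, 2nd ed., AMS 2010, §2.3.1, §7.1.2 (b).
  [Evans2010]
-/

noncomputable section

open MeasureTheory TopologicalSpace Set Function Filter Topology InnerProductSpace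
open scoped RealInnerProductSpace ENNReal NNReal Laplacian

namespace Literature.Analysis.FluidPDE

variable {E : Type*} [NormedAddCommGroup E] [InnerProductSpace ℝ E] [FiniteDimensional ℝ E]

/-! ### Slices and time lines of a jointly smooth field -/

section Slices

variable {F : Type*} [NormedAddCommGroup F] [NormedSpace ℝ F]

omit [InnerProductSpace ℝ E] [FiniteDimensional ℝ E] in
variable [NormedSpace ℝ E] in
/-- The time slices of a jointly `C^n` space–time field are `C^n`. [folklore] -/
theorem contDiff_slice_field {n : WithTop ℕ∞} {e : ℝ → E → F}
    (he : ContDiff ℝ n (uncurry e)) (t : ℝ) : ContDiff ℝ n (e t) :=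
  he.comp (contDiff_prodMk_right t)

omit [InnerProductSpace ℝ E] [FiniteDimensional ℝ E] in
variable [NormedSpace ℝ E] in
/-- The time lines `s ↦ e s x` of a jointly `C^n` space–time field are `C^n`. [folklore] -/
theorem contDiff_timeLine_field {n : WithTop ℕ∞} {e : ℝ → E → F}
    (he : ContDiff ℝ n (uncurry e)) (x : E) : ContDiff ℝ n fun s => e s x :=
  he.comp (contDiff_prodMk_left x)

end Slices

/-! ### The test field `ψ = φ e` and its Leibniz rules -/

section TestField

variable {F : Type*} [NormedAddCommGroup F] [NormedSpace ℝ F]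

omit [InnerProductSpace ℝ E] [FiniteDimensional ℝ E] in
variable [NormedSpace ℝ E] in
/-- **`φ e` is a test field** when `φ` is a scalar space–time test function on `Q` and `e` is a
globally smooth space–time field (the admissible test `ψ = φ u₁` of the cross balance `u·u₁`,
Lemarié-Rieusset 2016, p. 515). [folklore] -/
theorem IsSpaceTimeTestOn.smul_field {Q : Opens (ℝ × E)} {φ : ℝ → E → ℝ}
    (hφ : IsSpaceTimeTestOn Q φ) {e : ℝ → E → F} (he : ContDiff ℝ (⊤ : ℕ∞) (uncurry e)) :
    IsSpaceTimeTestOn Q fun t x => φ t x • e t x := by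
  have heq : uncurry (fun t x => φ t x • e t x) = fun z => uncurry φ z • uncurry e z := rfl
  refine ⟨?_, ?_, ?_⟩
  · rw [heq]; exact hφ.contDiff.smul he
  · rw [heq]; exact hφ.hasCompactSupport.smul_right
  · rw [heq]
    exact (tsupport_smul_subset_left (uncurry φ) (uncurry e)).trans hφ.tsupport_subset

omit [InnerProductSpace ℝ E] [FiniteDimensional ℝ E] in
variable [NormedSpace ℝ E] in
/-- **Time derivative of `φ e`**: `∂ₜ(φ e) = (∂ₜφ) e + φ ∂ₜe`. [folklore] -/
theorem timeDeriv_smul_field {φ : ℝ → E → ℝ} {e : ℝ → E → F}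
    (hφ : ContDiff ℝ (⊤ : ℕ∞) (uncurry φ)) (he : ContDiff ℝ (⊤ : ℕ∞) (uncurry e)) (t : ℝ) (x : E) :
    timeDeriv (fun s y => φ s y • e s y) t x =
      timeDeriv φ t x • e t x + φ t x • deriv (fun s => e s x) t := by
  have h1 : DifferentiableAt ℝ (fun s => φ s x) t :=
    ((contDiff_timeLine_field hφ x).differentiable (by simp)) t
  have h2 : DifferentiableAt ℝ (fun s => e s x) t :=
    ((contDiff_timeLine_field he x).differentiable (by simp)) t
  simp only [timeDeriv_apply]
  rw [deriv_fun_smul h1 h2, add_comm]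

omit [InnerProductSpace ℝ E] [FiniteDimensional ℝ E] in
variable [NormedSpace ℝ E] in
/-- **Spatial derivative of `φ e`**: `D(φ e)(v) = (∂ᵥφ) e + φ De(v)`. [folklore] -/
theorem fderiv_smul_field_apply {φ : E → ℝ} {e : E → F} {x : E}
    (hφ : DifferentiableAt ℝ φ x) (he : DifferentiableAt ℝ e x) (v : E) :
    fderiv ℝ (fun y => φ y • e y) x v = fderiv ℝ φ x v • e x + φ x • fderiv ℝ e x v := by
  rw [fderiv_fun_smul hφ he]
  simp [add_comm]

/-- **Convective derivative of `φ e`**: `(u·∇)(φ e) = ⟪u, ∇φ⟫ e + φ (u·∇)e`. [folklore] -/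
theorem convect_smul_field {F' : Type*} [NormedAddCommGroup F'] [InnerProductSpace ℝ F']
    {φ : E → ℝ} {e : E → F'} {u : E → E} {x : E}
    (hφ : DifferentiableAt ℝ φ x) (he : DifferentiableAt ℝ e x) :
    convect u (fun y => φ y • e y) x = ⟪u x, gradient φ x⟫ • e x + φ x • convect u e x := by
  simp only [convect]
  rw [fderiv_smul_field_apply hφ he]
  congr 2
  rw [real_inner_comm, gradient, InnerProductSpace.toDual_symm_apply]

/-- **Divergence of `φ e` for divergence-free `e`**: `div (φ e) = ⟪e, ∇φ⟫`. [folklore] -/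
theorem divergence_smul_field {φ : E → ℝ} {e : E → E} {x : E}
    (hφ : DifferentiableAt ℝ φ x) (he : DifferentiableAt ℝ e x)
    (hdiv : VectorCalculus.divergence e x = 0) :
    VectorCalculus.divergence (fun y => φ y • e y) x = ⟪e x, gradient φ x⟫ := by
  rw [divergence_smul_apply hφ he, hdiv, mul_zero, zero_add]

/-- The sum `Σᵢ (∂ᵢφ) ∂ᵢe` over an orthonormal basis is `De(∇φ)`. [folklore] -/
theorem sum_fderiv_smul_fderiv_eq {ι : Type*} [Fintype ι] (b : OrthonormalBasis ι ℝ E)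
    (φ : E → ℝ) (e : E → F) (x : E) :
    ∑ i, fderiv ℝ φ x (b i) • fderiv ℝ e x (b i) = fderiv ℝ e x (gradient φ x) := by
  have hg : gradient φ x = ∑ i, fderiv ℝ φ x (b i) • b i := by
    conv_lhs => rw [← b.sum_repr' (gradient φ x)]
    refine Finset.sum_congr rfl fun i _ => ?_
    rw [real_inner_comm, gradient, InnerProductSpace.toDual_symm_apply]
  rw [hg, map_sum]
  simp

/-- **Laplacian of `φ e`**: `Δ(φ e) = φ Δe + 2 De(∇φ) + (Δφ) e` for `C²` functions. [folklore] -/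
theorem laplacian_smul_field {F' : Type*} [NormedAddCommGroup F'] [InnerProductSpace ℝ F']
    {φ : E → ℝ} {e : E → F'} (hφ : ContDiff ℝ 2 φ) (he : ContDiff ℝ 2 e) (x : E) :
    (Δ (fun y => φ y • e y)) x =
      φ x • (Δ e) x + (2 : ℝ) • fderiv ℝ e x (gradient φ x) + ((Δ φ) x) • e x := by
  rw [laplacian_smul_apply hφ he x, sum_fderiv_smul_fderiv_eq]

end TestField

/-! ### Slice identities for a `C²` field against a compactly supported weight -/

section SliceIdentities

variable [MeasurableSpace E] [BorelSpace E]
variable {F' : Type*} [NormedAddCommGroup F'] [InnerProductSpace ℝ F'] [FiniteDimensional ℝ F']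

/-- **`∫ θ ⟪Δv, v⟫ = -∫ θ |Dv|² - ∫ ⟪Dv(∇θ), v⟫`** for `v ∈ C²` and a `C²` compactly supported
weight `θ` (Green's first identity without boundary applied to `v` and `θ v`; Evans, *PDE*,
App. C.2, Thm. 3). [folklore] -/
theorem integral_mul_inner_laplacian_self {v : E → F'} {θ : E → ℝ} (hv : ContDiff ℝ 2 v)
    (hθ : ContDiff ℝ 2 θ) (hθc : HasCompactSupport θ) :
    ∫ x, θ x * ⟪(Δ v) x, v x⟫ =
      -(∫ x, θ x * frobeniusNormSq (fderiv ℝ v x)) - ∫ x, ⟪fderiv ℝ v x (gradient θ x), v x⟫ := by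
  set b := stdOrthonormalBasis ℝ E with hb
  have hv1 : ContDiff ℝ 1 v := hv.of_le one_le_two
  have hθ1 : ContDiff ℝ 1 θ := hθ.of_le one_le_two
  have hw : ContDiff ℝ 1 fun y => θ y • v y := hθ1.smul hv1
  have hwc : HasCompactSupport fun y => θ y • v y := hθc.smul_right
  have key := integral_inner_laplacian_add_eq_zero b hv hw (Or.inr hwc)
  -- the Laplacian term
  have h1 : ∫ x, ⟪(Δ v) x, θ x • v x⟫ = ∫ x, θ x * ⟪(Δ v) x, v x⟫ :=
    integral_congr_ae (Eventually.of_forall fun x => by simp [real_inner_smul_right])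
  -- the gradient terms
  have hθd : ∀ y, DifferentiableAt ℝ θ y := fun y => hθ1.differentiable one_ne_zero y
  have hvd : ∀ y, DifferentiableAt ℝ v y := fun y => hv1.differentiable one_ne_zero y
  have hcont_dv : ∀ i, Continuous fun y => fderiv ℝ v y (b i) := fun i =>
    (hv.continuous_fderiv (by simp)).clm_apply continuous_const
  have hcont_dθ : ∀ i, Continuous fun y => fderiv ℝ θ y (b i) := fun i =>
    (hθ.continuous_fderiv (by simp)).clm_apply continuous_const
  have hA : ∀ i, Integrable (fun y => θ y * ‖fderiv ℝ v y (b i)‖ ^ 2) volume := fun i =>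
    (hθ.continuous.mul ((hcont_dv i).norm.pow 2)).integrable_of_hasCompactSupport hθc.mul_right
  have hB : ∀ i, Integrable (fun y => fderiv ℝ θ y (b i) * ⟪fderiv ℝ v y (b i), v y⟫) volume :=
    fun i => ((hcont_dθ i).mul ((hcont_dv i).inner hv.continuous)).integrable_of_hasCompactSupport
      ((hθc.fderiv_apply (𝕜 := ℝ) (b i)).mul_right)
  have h2 : ∀ i, ∫ x, ⟪fderiv ℝ v x (b i), fderiv ℝ (fun y => θ y • v y) x (b i)⟫ =
      (∫ x, θ x * ‖fderiv ℝ v x (b i)‖ ^ 2) +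
        ∫ x, fderiv ℝ θ x (b i) * ⟪fderiv ℝ v x (b i), v x⟫ := fun i => by
    rw [← integral_add (hA i) (hB i)]
    refine integral_congr_ae (Eventually.of_forall fun x => ?_)
    dsimp only
    rw [fderiv_smul_field_apply (hθd x) (hvd x), inner_add_right, real_inner_smul_right,
      real_inner_smul_right, real_inner_self_eq_norm_sq]
    ring
  have h3 : ∑ i, ∫ x, ⟪fderiv ℝ v x (b i), fderiv ℝ (fun y => θ y • v y) x (b i)⟫ =
      (∫ x, θ x * frobeniusNormSq (fderiv ℝ v x)) +
        ∫ x, ⟪fderiv ℝ v x (gradient θ x), v x⟫ := by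
    simp only [h2, Finset.sum_add_distrib]
    congr 1
    · rw [← integral_finsetSum _ fun i _ => hA i]
      refine integral_congr_ae (Eventually.of_forall fun x => ?_)
      dsimp only
      rw [frobeniusNormSq_eq_sum b, Finset.mul_sum]
    · rw [← integral_finsetSum _ fun i _ => hB i]
      refine integral_congr_ae (Eventually.of_forall fun x => ?_)
      dsimp only
      rw [← sum_fderiv_smul_fderiv_eq b θ v x, sum_inner]
      refine Finset.sum_congr rfl fun i _ => ?_
      rw [real_inner_smul_left]
  rw [h1, h3] at key
  linarith

omit [FiniteDimensional ℝ F'] in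
/-- **`∫ ⟪Dv(∇θ), v⟫ = -½ ∫ |v|² Δθ`** for `v ∈ C¹` and a `C²` compactly supported weight `θ`
(Green's identity for `θ` and `|v|²`: `∫ Δθ |v|² = -∫ ⟪∇θ, ∇|v|²⟫ = -2 ∫ ⟪Dv(∇θ), v⟫`). [folklore] -/
theorem integral_inner_fderiv_gradient_self {v : E → F'} {θ : E → ℝ} (hv : ContDiff ℝ 1 v)
    (hθ : ContDiff ℝ 2 θ) (hθc : HasCompactSupport θ) :
    ∫ x, ⟪fderiv ℝ v x (gradient θ x), v x⟫ = -(1 / 2 : ℝ) * ∫ x, ‖v x‖ ^ 2 * (Δ θ) x := by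
  set b := stdOrthonormalBasis ℝ E with hb
  have hw : ContDiff ℝ 1 fun y => ‖v y‖ ^ 2 := by
    have : (fun y => ‖v y‖ ^ 2) = fun y => ⟪v y, v y⟫ := funext fun y =>
      (real_inner_self_eq_norm_sq _).symm
    rw [this]; exact hv.inner ℝ hv
  have key := integral_inner_laplacian_add_eq_zero (F' := ℝ) b hθ hw (Or.inl hθc)
  have hvd : ∀ y, DifferentiableAt ℝ v y := fun y => hv.differentiable one_ne_zero y
  have hcont_dv : ∀ i, Continuous fun y => fderiv ℝ v y (b i) := fun i =>
    (hv.continuous_fderiv one_ne_zero).clm_apply continuous_const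
  have hcont_dθ : ∀ i, Continuous fun y => fderiv ℝ θ y (b i) := fun i =>
    (hθ.continuous_fderiv (by simp)).clm_apply continuous_const
  have hderiv : ∀ i x, fderiv ℝ (fun y => ‖v y‖ ^ 2) x (b i) = 2 * ⟪fderiv ℝ v x (b i), v x⟫ := by
    intro i x
    have : (fun y => ‖v y‖ ^ 2) = fun y => ⟪v y, v y⟫ := funext fun y =>
      (real_inner_self_eq_norm_sq _).symm
    rw [this, fderiv_inner_apply ℝ (hvd x) (hvd x), real_inner_comm (v x)]
    ring
  have hB : ∀ i, Integrable (fun y => fderiv ℝ θ y (b i) * ⟪fderiv ℝ v y (b i), v y⟫) volume :=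
    fun i => ((hcont_dθ i).mul ((hcont_dv i).inner hv.continuous)).integrable_of_hasCompactSupport
      ((hθc.fderiv_apply (𝕜 := ℝ) (b i)).mul_right)
  have h1 : ∫ x, ⟪(Δ θ) x, ‖v x‖ ^ 2⟫ = ∫ x, ‖v x‖ ^ 2 * (Δ θ) x :=
    integral_congr_ae (Eventually.of_forall fun x => by simp)
  have h2 : ∀ i, ∫ x, ⟪fderiv ℝ θ x (b i), fderiv ℝ (fun y => ‖v y‖ ^ 2) x (b i)⟫ =
      2 * ∫ x, fderiv ℝ θ x (b i) * ⟪fderiv ℝ v x (b i), v x⟫ := fun i => by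
    rw [← integral_const_mul]
    refine integral_congr_ae (Eventually.of_forall fun x => ?_)
    simp only [hderiv, RCLike.inner_apply, conj_trivial]
    ring
  have h3 : ∑ i, ∫ x, ⟪fderiv ℝ θ x (b i), fderiv ℝ (fun y => ‖v y‖ ^ 2) x (b i)⟫ =
      2 * ∫ x, ⟪fderiv ℝ v x (gradient θ x), v x⟫ := by
    simp only [h2, ← Finset.mul_sum]
    congr 1
    rw [← integral_finsetSum _ fun i _ => hB i]
    refine integral_congr_ae (Eventually.of_forall fun x => ?_)
    dsimp only
    rw [← sum_fderiv_smul_fderiv_eq b θ v x, sum_inner]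
    refine Finset.sum_congr rfl fun i _ => ?_
    rw [real_inner_smul_left]
  rw [h1, h3] at key
  linarith

/-- **`∫ θ ⟪Dv(v), v⟫ = -½ ∫ ⟪v, ∇θ⟫ |v|²`** for a divergence-free `v ∈ C¹` and a `C¹`
compactly supported weight `θ` (the trilinear identity `∫ ⟪(v·∇)v, θ v⟫ + ∫ ⟪v, (v·∇)(θ v)⟫ = 0`
with `(v·∇)(θv) = ⟪v, ∇θ⟫ v + θ (v·∇)v`; Leray 1934, §17 (3.4)). [folklore] -/
theorem integral_mul_inner_convect_self_of_isDivFree {v : E → E} {θ : E → ℝ}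
    (hv : ContDiff ℝ 1 v) (hdiv : VectorCalculus.IsDivFree v) (hθ : ContDiff ℝ 1 θ)
    (hθc : HasCompactSupport θ) :
    ∫ x, θ x * ⟪fderiv ℝ v x (v x), v x⟫ = -(1 / 2 : ℝ) * ∫ x, ⟪v x, gradient θ x⟫ * ‖v x‖ ^ 2 := by
  have hw : ContDiff ℝ 1 fun y => θ y • v y := hθ.smul hv
  have hwc : HasCompactSupport fun y => θ y • v y := hθc.smul_right
  have key := integral_inner_convect_add_eq_zero hv hv hw hwc
  have hθd : ∀ y, DifferentiableAt ℝ θ y := fun y => hθ.differentiable one_ne_zero y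
  have hvd : ∀ y, DifferentiableAt ℝ v y := fun y => hv.differentiable one_ne_zero y
  have hdiv0 : ∫ x, VectorCalculus.divergence v x * ⟪v x, θ x • v x⟫ = 0 := by
    simp [hdiv _]
  have hcv : Continuous fun y => convect v v y :=
    (hv.continuous_fderiv one_ne_zero).clm_apply hv.continuous
  have hI1 : Integrable (fun x => θ x * ⟪fderiv ℝ v x (v x), v x⟫) volume :=
    (hθ.continuous.mul (hcv.inner hv.continuous)).integrable_of_hasCompactSupport hθc.mul_right
  have hI2 : Integrable (fun x => ⟪v x, gradient θ x⟫ * ‖v x‖ ^ 2) volume := by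
    refine ((hv.continuous.inner (continuous_gradient_of_contDiff hθ)).mul
      (hv.continuous.norm.pow 2)).integrable_of_hasCompactSupport ?_
    refine HasCompactSupport.intro hθc fun x hx => ?_
    simp only [Pi.mul_apply, Pi.pow_apply, gradient_eq_zero_of_notMem_tsupport hx,
      inner_zero_right, zero_mul]
  have h1 : ∫ x, ⟪convect v v x, θ x • v x⟫ = ∫ x, θ x * ⟪fderiv ℝ v x (v x), v x⟫ :=
    integral_congr_ae (Eventually.of_forall fun x => by
      simp [convect, real_inner_smul_right])
  have h2 : ∫ x, ⟪v x, convect v (fun y => θ y • v y) x⟫ =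
      (∫ x, ⟪v x, gradient θ x⟫ * ‖v x‖ ^ 2) + ∫ x, θ x * ⟪fderiv ℝ v x (v x), v x⟫ := by
    rw [← integral_add hI2 hI1]
    refine integral_congr_ae (Eventually.of_forall fun x => ?_)
    dsimp only
    rw [convect_smul_field (hθd x) (hvd x), inner_add_right, real_inner_smul_right,
      real_inner_smul_right, real_inner_self_eq_norm_sq, convect, real_inner_comm (v x)]
  rw [h1, h2, hdiv0] at key
  linarith

end SliceIdentities

/-! ### The classical local energy identity of the heat flow -/

section HeatIdentity

variable {F' : Type*} [NormedAddCommGroup F'] [InnerProductSpace ℝ F']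

/-- **Time lines: `∫ |e|² φ' = -2 ∫ φ ⟪e, e'⟫`** for `e ∈ C¹(ℝ; F')` and `φ ∈ C¹_c(ℝ)` (integration
by parts in time, no boundary terms). [folklore] -/
theorem integral_norm_sq_mul_deriv {e : ℝ → F'} {φ : ℝ → ℝ} (he : ContDiff ℝ 1 e)
    (hφ : ContDiff ℝ 1 φ) (hφc : HasCompactSupport φ) :
    ∫ s, ‖e s‖ ^ 2 * deriv φ s = -2 * ∫ s, φ s * ⟪e s, deriv e s⟫ := by
  have hed : ∀ s, HasDerivAt e (deriv e s) s := fun s =>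
    ((he.differentiable one_ne_zero) s).hasDerivAt
  have hφd : ∀ s, HasDerivAt φ (deriv φ s) s := fun s =>
    ((hφ.differentiable one_ne_zero) s).hasDerivAt
  have hg : ∀ s, HasDerivAt (fun s => ‖e s‖ ^ 2 * φ s)
      (2 * ⟪e s, deriv e s⟫ * φ s + ‖e s‖ ^ 2 * deriv φ s) s := fun s =>
    ((hed s).norm_sq).mul (hφd s)
  have hec : Continuous e := he.continuous
  have he'c : Continuous (deriv e) := he.continuous_deriv le_rfl
  have hφ'c : Continuous (deriv φ) := hφ.continuous_deriv le_rfl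
  have hI1 : Integrable (fun s => 2 * ⟪e s, deriv e s⟫ * φ s) volume :=
    ((continuous_const.mul (hec.inner he'c)).mul hφ.continuous).integrable_of_hasCompactSupport
      hφc.mul_left
  have hI2 : Integrable (fun s => ‖e s‖ ^ 2 * deriv φ s) volume :=
    ((hec.norm.pow 2).mul hφ'c).integrable_of_hasCompactSupport hφc.deriv.mul_left
  have hI : Integrable (fun s => ‖e s‖ ^ 2 * φ s) volume :=
    ((hec.norm.pow 2).mul hφ.continuous).integrable_of_hasCompactSupport hφc.mul_left
  have h0 := integral_eq_zero_of_hasDerivAt_of_integrable hg (hI1.add hI2) hI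
  rw [integral_add hI1 hI2] at h0
  have h1 : ∫ s, 2 * ⟪e s, deriv e s⟫ * φ s = 2 * ∫ s, φ s * ⟪e s, deriv e s⟫ := by
    rw [← integral_const_mul]
    exact integral_congr_ae (Eventually.of_forall fun s => by ring)
  linarith

variable [MeasurableSpace E] [BorelSpace E] [FiniteDimensional ℝ F']

omit [MeasurableSpace E] [BorelSpace E] [FiniteDimensional ℝ F'] [FiniteDimensional ℝ E]
  [InnerProductSpace ℝ F'] in
variable [NormedSpace ℝ F'] in
/-- A globally smooth space–time field is smooth on the time set `univ` in the sense of
`IsSmoothSpaceTimeOn`. [folklore] -/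
theorem IsSmoothSpaceTimeOn.of_contDiff_univ {e : ℝ → E → F'}
    (he : ContDiff ℝ (⊤ : ℕ∞) (uncurry e)) : IsSmoothSpaceTimeOn univ e := by
  rw [IsSmoothSpaceTimeOn, univ_prod_univ]
  exact he.contDiffOn

omit [MeasurableSpace E] [BorelSpace E] [FiniteDimensional ℝ F'] [FiniteDimensional ℝ E]
  [InnerProductSpace ℝ F'] in
variable [NormedSpace ℝ F'] in
/-- A field smooth on the time set `univ` (`IsSmoothSpaceTimeOn`) is jointly continuous. [folklore] -/
theorem IsSmoothSpaceTimeOn.continuous_of_univ {e : ℝ → E → F'} (he : IsSmoothSpaceTimeOn univ e) :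
    Continuous fun z : ℝ × E => e z.1 z.2 := by
  have := he.continuousOn
  rw [univ_prod_univ, continuousOn_univ] at this
  exact this

omit [MeasurableSpace E] [BorelSpace E] [FiniteDimensional ℝ F'] [InnerProductSpace ℝ E]
  [FiniteDimensional ℝ E] in
/-- Time lines of a compactly supported space–time function have compact support. [folklore] -/
theorem hasCompactSupport_timeLine {φ : ℝ → E → ℝ} (hφ : HasCompactSupport (uncurry φ)) (x : E) :
    HasCompactSupport fun s => φ s x := by
  refine HasCompactSupport.intro (hφ.image continuous_fst) fun s hs => ?_
  have : (s, x) ∉ tsupport (uncurry φ) := fun h => hs ⟨(s, x), h, rfl⟩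
  exact image_eq_zero_of_notMem_tsupport (f := uncurry φ) this

/-- **The classical local energy identity of the heat flow.** Let `e : ℝ → E → F'` be jointly
smooth, solving `∂ₜe = νΔe` at every point of an open `Ω ⊆ ℝ × E`, and let `φ ∈ C_c^∞(Ω)`. Then
`∫∫ |e|² ∂ₜφ + ν ∫∫ |e|² Δφ = 2ν ∫∫ |De|² φ` (integrals over `ℝ × E`): the distributional form of
`∂ₜ|e|² = νΔ|e|² - 2ν|∇e|²` (Lemarié-Rieusset 2016, p. 515, balance of `|u₁|²/2` for the
regular solution, here with zero force and zero pressure; Evans, *PDE*, §7.1.2). Proof: in `t`,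
`∫ |e|²φₜ dt = -2ν ∫ φ ⟪e, Δe⟫ dt` for every `x`; in `x`, Green's identity gives
`∫ φ⟪e, Δe⟫ dx = -∫ φ|De|² + ½ ∫ |e|² Δφ`; Fubini. [cite: LemarieRieusset2016, Thm. 14.7, proof p. 515] -/
theorem caloric_local_energy_identity {Ω : Opens (ℝ × E)} {ν : ℝ} {e : ℝ → E → F'}
    (he : ContDiff ℝ (⊤ : ℕ∞) (uncurry e))
    (hheat : ∀ z ∈ (Ω : Set (ℝ × E)), HasDerivAt (fun s => e s z.2) (ν • (Δ (e z.1)) z.2) z.1)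
    {φ : ℝ → E → ℝ} (hφ : IsSpaceTimeTestOn Ω φ) :
    (∫ z : ℝ × E, ‖e z.1 z.2‖ ^ 2 * timeDeriv φ z.1 z.2) +
        ν * ∫ z : ℝ × E, ‖e z.1 z.2‖ ^ 2 * (Δ (φ z.1)) z.2 =
      2 * ν * ∫ z : ℝ × E, φ z.1 z.2 * frobeniusNormSq (fderiv ℝ (e z.1) z.2) := by
  set b := stdOrthonormalBasis ℝ E with hb
  -- ## smoothness and continuity
  have hes : IsSmoothSpaceTimeOn univ e := IsSmoothSpaceTimeOn.of_contDiff_univ he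
  have hφs : IsSmoothSpaceTimeOn univ φ := hφ.isSmoothSpaceTimeOn univ
  have he_c : Continuous fun z : ℝ × E => e z.1 z.2 := hes.continuous_of_univ
  have hφ_c : Continuous fun z : ℝ × E => φ z.1 z.2 := hφs.continuous_of_univ
  have hlap_c : Continuous fun z : ℝ × E => (Δ (e z.1)) z.2 :=
    (hes.laplacian uniqueDiffOn_univ).continuous_of_univ
  have hlapφ_c : Continuous fun z : ℝ × E => (Δ (φ z.1)) z.2 :=
    (hφs.laplacian uniqueDiffOn_univ).continuous_of_univ
  have hD_c : Continuous fun z : ℝ × E => fderiv ℝ (e z.1) z.2 :=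
    (hes.fderiv_slice uniqueDiffOn_univ).continuous_of_univ
  have hgradφ_c : Continuous fun z : ℝ × E => gradient (φ z.1) z.2 :=
    (hφs.gradient uniqueDiffOn_univ).continuous_of_univ
  have hφt_c : Continuous fun z : ℝ × E => timeDeriv φ z.1 z.2 := hφ.continuous_timeDeriv
  have hfrob_c : Continuous fun z : ℝ × E => frobeniusNormSq (fderiv ℝ (e z.1) z.2) := by
    have : (fun z : ℝ × E => frobeniusNormSq (fderiv ℝ (e z.1) z.2)) =
        fun z => ∑ i, ‖fderiv ℝ (e z.1) z.2 (b i)‖ ^ 2 := funext fun z => frobeniusNormSq_eq_sum b _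
    rw [this]
    exact continuous_finsetSum _ fun i _ => ((hD_c.clm_apply continuous_const).norm).pow 2
  have he2 : ∀ t, ContDiff ℝ 2 (e t) := fun t => contDiff_infty.1 (contDiff_slice_field (F := F') he t) 2
  have he1 : ∀ t, ContDiff ℝ 1 (e t) := fun t => (he2 t).of_le one_le_two
  have hφ2 : ∀ t, ContDiff ℝ 2 (φ t) := fun t => contDiff_infty.1 (hφ.contDiff_slice t) 2
  have hφc_slice : ∀ t, HasCompactSupport (φ t) := hφ.hasCompactSupport_slice
  -- ## the support
  set K : Set (ℝ × E) := tsupport (uncurry φ) with hK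
  have hKc : IsCompact K := hφ.hasCompactSupport
  have hKΩ : K ⊆ (Ω : Set (ℝ × E)) := hφ.tsupport_subset
  have hφK : ∀ z : ℝ × E, z ∉ K → φ z.1 z.2 = 0 := fun z hz =>
    image_eq_zero_of_notMem_tsupport (f := uncurry φ) hz
  have hφtK : ∀ z : ℝ × E, z ∉ K → timeDeriv φ z.1 z.2 = 0 := fun z hz =>
    IsSpaceTimeTestOn.timeDeriv_eq_zero_of_notMem hz
  have hnear : ∀ z : ℝ × E, z ∉ K → φ z.1 =ᶠ[𝓝 z.2] fun _ => (0 : ℝ) := fun z hz => by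
    have h0 : uncurry φ =ᶠ[𝓝 (z.1, z.2)] 0 := notMem_tsupport_iff_eventuallyEq.1 hz
    have hc : Continuous fun y : E => (z.1, y) := continuous_const.prodMk continuous_id
    exact (hc.tendsto z.2).eventually h0
  have hlapK : ∀ z : ℝ × E, z ∉ K → (Δ (φ z.1)) z.2 = 0 := fun z hz => by
    rw [(InnerProductSpace.laplacian_congr_nhds (hnear z hz)).self_of_nhds,
      InnerProductSpace.laplacian_const, Pi.zero_apply]
  -- compactly supported continuous integrands are integrable
  have hint : ∀ {f : ℝ × E → ℝ}, Continuous f → (∀ z ∉ K, f z = 0) → Integrable f volume :=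
    fun hf h0 => hf.integrable_of_hasCompactSupport (HasCompactSupport.intro hKc h0)
  -- ## the heat equation on the support
  have hderiv : ∀ z : ℝ × E, φ z.1 z.2 * ⟪e z.1 z.2, deriv (fun s => e s z.2) z.1⟫ =
      ν * (φ z.1 z.2 * ⟪e z.1 z.2, (Δ (e z.1)) z.2⟫) := by
    intro z
    by_cases hz : φ z.1 z.2 = 0
    · simp [hz]
    · have hzΩ : z ∈ (Ω : Set (ℝ × E)) := hKΩ (subset_tsupport _ (by exact hz))
      rw [(hheat z hzΩ).deriv, inner_smul_right]
      ring
  -- ## Step 1: integration by parts in time, `∫∫ |e|² φₜ = -2ν ∫∫ φ ⟪e, Δe⟫`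
  have hI_t : Integrable (fun z : ℝ × E => ‖e z.1 z.2‖ ^ 2 * timeDeriv φ z.1 z.2) volume :=
    hint ((he_c.norm.pow 2).mul hφt_c) fun z hz => by rw [hφtK z hz, mul_zero]
  have hI_el : Integrable (fun z : ℝ × E => φ z.1 z.2 * ⟪e z.1 z.2, (Δ (e z.1)) z.2⟫) volume :=
    hint (hφ_c.mul (he_c.inner hlap_c)) fun z hz => by rw [hφK z hz, zero_mul]
  have step1 : ∫ z : ℝ × E, ‖e z.1 z.2‖ ^ 2 * timeDeriv φ z.1 z.2 =
      -2 * ν * ∫ z : ℝ × E, φ z.1 z.2 * ⟪e z.1 z.2, (Δ (e z.1)) z.2⟫ := by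
    rw [Measure.volume_eq_prod, integral_prod_symm _ hI_t, integral_prod_symm _ hI_el,
      ← integral_const_mul]
    refine integral_congr_ae (Eventually.of_forall fun x => ?_)
    dsimp only
    have h1 := integral_norm_sq_mul_deriv (e := fun s => e s x) (φ := fun s => φ s x)
      (contDiff_infty.1 (contDiff_timeLine_field he x) 1)
      (contDiff_infty.1 (contDiff_timeLine_field hφ.contDiff x) 1)
      (hasCompactSupport_timeLine hφ.hasCompactSupport x)
    have h2 : (fun s => ‖e s x‖ ^ 2 * timeDeriv φ s x) =
        fun s => ‖e s x‖ ^ 2 * deriv (fun s => φ s x) s :=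
      funext fun s => by rw [timeDeriv_apply]
    have h3 : ∫ s, φ s x * ⟪e s x, deriv (fun s => e s x) s⟫ =
        ν * ∫ s, φ s x * ⟪e s x, (Δ (e s)) x⟫ := by
      rw [← integral_const_mul]
      exact integral_congr_ae (Eventually.of_forall fun s => hderiv (s, x))
    rw [h2, h1, h3]
    ring
  -- ## Step 2: Green's identity in space, slice by slice
  have hI_A : Integrable (fun z : ℝ × E => φ z.1 z.2 * frobeniusNormSq (fderiv ℝ (e z.1) z.2))
      volume :=
    hint (hφ_c.mul hfrob_c) fun z hz => by rw [hφK z hz, zero_mul]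
  have hI_B : Integrable (fun z : ℝ × E => ‖e z.1 z.2‖ ^ 2 * (Δ (φ z.1)) z.2) volume :=
    hint ((he_c.norm.pow 2).mul hlapφ_c) fun z hz => by rw [hlapK z hz, mul_zero]
  set A : ℝ → ℝ := fun t => ∫ x, φ t x * frobeniusNormSq (fderiv ℝ (e t) x) with hA
  set B : ℝ → ℝ := fun t => ∫ x, ‖e t x‖ ^ 2 * (Δ (φ t)) x with hB
  have hAint : Integrable A volume := hI_A.integral_prod_left
  have hBint : Integrable B volume := hI_B.integral_prod_left
  have hslice : ∀ t, ∫ x, φ t x * ⟪e t x, (Δ (e t)) x⟫ = -A t + (1 / 2 : ℝ) * B t := by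
    intro t
    have h₁ := integral_mul_inner_laplacian_self (he2 t) (hφ2 t) (hφc_slice t)
    have h₂ := integral_inner_fderiv_gradient_self (he1 t) (hφ2 t) (hφc_slice t)
    have hcomm : ∫ x, φ t x * ⟪e t x, (Δ (e t)) x⟫ = ∫ x, φ t x * ⟪(Δ (e t)) x, e t x⟫ :=
      integral_congr_ae (Eventually.of_forall fun x => by dsimp only; rw [real_inner_comm])
    rw [hcomm, h₁, h₂, hA, hB]
    ring
  have step2 : ∫ z : ℝ × E, φ z.1 z.2 * ⟪e z.1 z.2, (Δ (e z.1)) z.2⟫ =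
      -(∫ z : ℝ × E, φ z.1 z.2 * frobeniusNormSq (fderiv ℝ (e z.1) z.2)) +
        (1 / 2 : ℝ) * ∫ z : ℝ × E, ‖e z.1 z.2‖ ^ 2 * (Δ (φ z.1)) z.2 := by
    rw [Measure.volume_eq_prod, integral_prod _ hI_el, integral_prod _ hI_A, integral_prod _ hI_B]
    change ∫ t, ∫ x, φ t x * ⟪e t x, (Δ (e t)) x⟫ = -(∫ t, A t) + (1 / 2 : ℝ) * ∫ t, B t
    have hAneg : Integrable (fun t => -A t) volume := hAint.neg
    have hBmul : Integrable (fun t => (1 / 2 : ℝ) * B t) volume := hBint.const_mul _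
    have hsum : ∫ t, (-A t + (1 / 2 : ℝ) * B t) = -(∫ t, A t) + (1 / 2 : ℝ) * ∫ t, B t := by
      rw [integral_add hAneg hBmul, integral_neg, integral_const_mul]
    rw [← hsum]
    exact integral_congr_ae (Eventually.of_forall fun t => hslice t)
  -- ## conclusion
  rw [step1, step2]
  ring

end HeatIdentity

end Literature.Analysis.FluidPDE
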